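import Summits.CriticalPhenomena.PercolationContinuityZ3.Theorems.PercNearOneGluingNoHeavyLowerTailIncStarTwoCutFXForm
import Summits.CriticalPhenomena.PercolationContinuityZ3.Theorems.PercNearOneGluingNoHeavyLowerTailIncStarTwoCutFXCertTargetPos
import Summits.CriticalPhenomena.PercolationContinuityZ3.Theorems.PercNearOneGluingNoHeavyLowerTailIncStarTwoCutFXCertTargetNeg
import Summits.CriticalPhenomena.PercolationContinuityZ3.Theorems.PercNearOneGluingNoHeavyLowerTailIncStarTwoCutFYCertTargetPos
import Summits.CriticalPhenomena.PercolationContinuityZ3.Theorems.PercNearOneGluingNoHeavyLowerTailIncStarTwoCutFYCertTargetNeg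
import HarnessLib

/-!
# MODE B, XXII: the certificate targets ARE `D` times the structured (FX)/(FY) forms (COMPUTATIONAL: two `native_decide`)

Support file for the Sahi programme (`--supports stmt-CriticalPhenomena-4575`, prover prim-sahi-p2 gen 28).  `fxForm_checkN`: the normal
form (`Expr.toPoly`) of `166668 · fxFormE` (`…IncStarTwoCutFXForm`, the structured bihomogeneous (FX) form) coincides with that of the
tabulated target `ftargetE fxTargetPos fxTargetNeg` (gen 27, 7184 monomials); `fyForm_checkN`: the same for `144432 · fyFormE` and the (FY)
target.  Evaluated by `native_decide` exactly like `fx_cert_checkN` / `fy_cert_checkN` (`…IncStarTwoCutFXCert`, `…FYCert`; computational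
ancestry `Lean.ofReduceBool`); the identity was verified independently in exact integer arithmetic (gen28 `checkform.py`: 7184 = 7184 terms,
equal).  Soundness in `ℝ`: `Expr.eq_of_toPoly_eq` (used in `…IncStarTwoCutFX`).
-/

namespace Summit.CriticalPhenomena.PercolationContinuityZ3.Theorems

namespace IncStarTwoCut.FXCert

open Lean.Grind.CommRing FourPointCert

set_option maxRecDepth 100000 in
/-- **`166668 · FX_form ≡ target(FX)`** as normal forms (COMPUTATIONAL: `native_decide`). [this work] -/
theorem fxForm_checkN : ((Expr.mul (.natCast 166668) fxFormE).toPoly == (ftargetE fxTargetPos fxTargetNeg).toPoly) = true := by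
  native_decide

set_option maxRecDepth 100000 in
/-- **`144432 · FY_form ≡ target(FY)`** as normal forms (COMPUTATIONAL: `native_decide`). [this work] -/
theorem fyForm_checkN : ((Expr.mul (.natCast 144432) fyFormE).toPoly == (ftargetE fyTargetPos fyTargetNeg).toPoly) = true := by
  native_decide

end IncStarTwoCut.FXCert

end Summit.CriticalPhenomena.PercolationContinuityZ3.Theorems
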